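import Literature.NumberTheory.ConnesMoscovici2022.UVProlateSpectrum
import Mathlib.Analysis.SpecialFunctions.Arsinh
import Mathlib.Analysis.SpecialFunctions.Log.Deriv
import HarnessLib

/-!
# Connes–Moscovici 2022, Proposition 3.2 PROVED: the semiclassical area `σ(E,λ)` of `Ω_λ(E)` is
# `(E/2π)(log(E/2π) − 1 + log 4 − 2 log λ) + λ² + o(1)`

RH-FREE corpus literature (an elementary asymptotic of a phase-space AREA — the paper's
"semiclassical approximation"; it says nothing about the true eigenvalue count, whose printed
identification with `2σ` stays recorded AS PRINTED in the named fact `CM22_thm_5_1`); cell rh-crit,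
corpus O2 row (typer seat t8), discharge by seat t16 along the route posted by seat t15; bears_on:
W-C/W-P (UV sequel, no leaf role).  WHAT THIS IS NOT: any claim about RH — nothing here bears on the
truth of RH.  Theorems only (no `def`, no named fact): `CM22_prop_3_2_holds : CM22_prop_3_2`
(net debt −1), everything else `private`.

Source: A. Connes, H. Moscovici, *The UV prolate spectrum matches the zeros of zeta*, PNAS 119
(2022) [bib: `ConnesMoscovici2022`], Prop. 3.2 eq. (3.5) (= arXiv:2112.05500 Prop. 4.2 (4.5), held
text chunk p0009:L74–L80, proof L82–L100).

## Proof

The printed proof combines (3.3) `σ(E,λ) = I_λ(a) = λ² I₁(a/λ⁴)`, `a = (E/2π)² + λ⁴`, Lemma 3.1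
`I₁(b) = bK(1−b) − E(1−b) + 1` — both landed (seat t8: `CM22_eq_3_3_holds`, `CM22_lemma_3_1_holds`)
— and the expansion (3.6) of `I₁(b)` as `b → ∞`, quoted from the classical asymptotics of the
complete elliptic integrals.  Mathlib has no elliptic integrals; (3.6) is replaced here by the
elementary estimate it amounts to.  With `u := E/(2πλ²)` one has EXACTLY `a/λ⁴ = 1 + u²`, and
for `b = 1 + u²`
`bK(1−b) − E(1−b) = ∫₀^{π/2} u²cos²θ/√(1+u²sin²θ) dθ = u·arsinh u − ∫₀^{π/2} u²cos θ(1−cos θ)/√(1+u²sin²θ) dθ`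
(FTC, antiderivative `u·arsinh(u sin θ)`), while the printed main term is `λ²(u log 4u − u + 1)`.
Three further elementary facts — `0 ≤ u·arsinh u − u log 2u ≤ 1/(4u)`;
`c₀ := ∫₀^{π/2} cos θ sin θ/(1+cos θ) dθ = 1 − log 2` (FTC); and the pointwise bound
`|u²cos θ(1−cos θ)/√(1+u²sin²θ) − u cos θ sin θ/(1+cos θ)| ≤ u cos θ sin θ/(1+u²sin²θ)` on
`(0, π/2]`, whose right side integrates to `log(1+u²)/(2u)` (FTC) — give
`|σ(E,λ) − main(E,λ)| ≤ λ²(1/(4u) + log(1+u²)/(2u)) → 0` (`E → ∞`).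
-/

noncomputable section

open Set MeasureTheory Filter Real intervalIntegral
open scoped Real Topology

namespace Literature.NumberTheory.ConnesMoscovici2022

section Semiclassical

/-! ### Three FTC evaluations on `[0, π/2]` -/

/-- `1 + u² sin²θ > 0`. [folklore] -/
private theorem one_add_sq_mul_sin_sq_pos (u θ : ℝ) : 0 < 1 + u ^ 2 * Real.sin θ ^ 2 := by
  positivity

/-- `∫₀^{π/2} u² cos θ/√(1+u² sin²θ) dθ = u·arsinh u` (antiderivative `u·arsinh(u sin θ)`). [folklore] -/
private theorem integral_sq_mul_cos_div_sqrt (u : ℝ) :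
    ∫ θ in (0 : ℝ)..(π / 2), u ^ 2 * Real.cos θ / Real.sqrt (1 + u ^ 2 * Real.sin θ ^ 2) =
      u * Real.arsinh u := by
  have hderiv : ∀ θ ∈ uIcc (0 : ℝ) (π / 2),
      HasDerivAt (fun θ => u * Real.arsinh (u * Real.sin θ))
        (u ^ 2 * Real.cos θ / Real.sqrt (1 + u ^ 2 * Real.sin θ ^ 2)) θ := by
    intro θ _
    have h1 : HasDerivAt (fun θ => u * Real.sin θ) (u * Real.cos θ) θ :=
      (Real.hasDerivAt_sin θ).const_mul u
    have h2 : HasDerivAt (fun θ => u * Real.arsinh (u * Real.sin θ))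
        (u * ((Real.sqrt (1 + (u * Real.sin θ) ^ 2))⁻¹ * (u * Real.cos θ))) θ := by
      have := ((Real.hasDerivAt_arsinh (u * Real.sin θ)).comp θ h1).const_mul u
      exact this
    refine h2.congr_deriv ?_
    rw [mul_pow, div_eq_mul_inv]
    ring
  rw [integral_eq_sub_of_hasDerivAt hderiv]
  · simp
  · apply Continuous.intervalIntegrable
    exact (continuous_const.mul Real.continuous_cos).div
      (Real.continuous_sqrt.comp (continuous_const.add
        (continuous_const.mul (Real.continuous_sin.pow 2))))
      fun θ => (Real.sqrt_pos.2 (one_add_sq_mul_sin_sq_pos u θ)).ne'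

/-- `c₀ = ∫₀^{π/2} cos θ sin θ/(1 + cos θ) dθ = 1 − log 2` (antiderivative `−cos θ + log(1 + cos θ)`). [folklore] -/
private theorem integral_cos_mul_sin_div_one_add_cos :
    ∫ θ in (0 : ℝ)..(π / 2), Real.cos θ * Real.sin θ / (1 + Real.cos θ) = 1 - Real.log 2 := by
  have hpos : ∀ θ ∈ uIcc (0 : ℝ) (π / 2), 0 < 1 + Real.cos θ := by
    intro θ hθ
    rw [uIcc_of_le (by positivity)] at hθ
    have := Real.cos_nonneg_of_mem_Icc ⟨by linarith [hθ.1, Real.pi_pos], hθ.2⟩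
    linarith
  have hderiv : ∀ θ ∈ uIcc (0 : ℝ) (π / 2),
      HasDerivAt (fun θ => -Real.cos θ + Real.log (1 + Real.cos θ))
        (Real.cos θ * Real.sin θ / (1 + Real.cos θ)) θ := by
    intro θ hθ
    have h0 := hpos θ hθ
    have h1 : HasDerivAt (fun θ => 1 + Real.cos θ) (-Real.sin θ) θ := by
      simpa using (Real.hasDerivAt_cos θ).const_add 1
    have h2 : HasDerivAt (fun θ => -Real.cos θ + Real.log (1 + Real.cos θ))
        (-(-Real.sin θ) + -Real.sin θ / (1 + Real.cos θ)) θ :=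
      ((Real.hasDerivAt_cos θ).neg).add (h1.log h0.ne')
    refine h2.congr_deriv ?_
    field_simp
    ring
  rw [integral_eq_sub_of_hasDerivAt hderiv]
  · norm_num; ring
  · refine ContinuousOn.intervalIntegrable fun θ hθ => ?_
    have h0 := hpos θ hθ
    exact ((Real.continuous_cos.mul Real.continuous_sin).continuousAt.div
      (continuous_const.add Real.continuous_cos).continuousAt h0.ne').continuousWithinAt

/-- `∫₀^{π/2} u cos θ sin θ/(1 + u² sin²θ) dθ = log(1+u²)/(2u)` for `u ≠ 0`
(antiderivative `log(1 + u² sin²θ)/(2u)`). [folklore] -/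
private theorem integral_mul_cos_mul_sin_div {u : ℝ} (hu : u ≠ 0) :
    ∫ θ in (0 : ℝ)..(π / 2), u * Real.cos θ * Real.sin θ / (1 + u ^ 2 * Real.sin θ ^ 2) =
      Real.log (1 + u ^ 2) / (2 * u) := by
  have hderiv : ∀ θ ∈ uIcc (0 : ℝ) (π / 2),
      HasDerivAt (fun θ => Real.log (1 + u ^ 2 * Real.sin θ ^ 2) / (2 * u))
        (u * Real.cos θ * Real.sin θ / (1 + u ^ 2 * Real.sin θ ^ 2)) θ := by
    intro θ _
    have h0 := one_add_sq_mul_sin_sq_pos u θ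
    have h1 : HasDerivAt (fun θ => 1 + u ^ 2 * Real.sin θ ^ 2)
        (u ^ 2 * (2 * Real.sin θ * Real.cos θ)) θ := by
      have := ((Real.hasDerivAt_sin θ).pow 2).const_mul (u ^ 2)
      simpa using this.const_add 1
    have h2 : HasDerivAt (fun θ => Real.log (1 + u ^ 2 * Real.sin θ ^ 2) / (2 * u))
        (u ^ 2 * (2 * Real.sin θ * Real.cos θ) / (1 + u ^ 2 * Real.sin θ ^ 2) / (2 * u)) θ :=
      (h1.log h0.ne').div_const (2 * u)
    refine h2.congr_deriv ?_
    field_simp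
  rw [integral_eq_sub_of_hasDerivAt hderiv]
  · simp
  · apply Continuous.intervalIntegrable
    exact ((continuous_const.mul Real.continuous_cos).mul Real.continuous_sin).div
      (continuous_const.add (continuous_const.mul (Real.continuous_sin.pow 2)))
      fun θ => (one_add_sq_mul_sin_sq_pos u θ).ne'

/-! ### The pointwise bound and `0 ≤ u·arsinh u − u·log 2u ≤ 1/(4u)` -/

/-- Real-variable core of the pointwise bound: for `s > 0`, `0 ≤ c ≤ 1`, `s² + c² = 1`, `u > 0`,
`|u²c(1−c)/√(1+u²s²) − u c s/(1+c)| ≤ u c s/(1+u²s²)`. [folklore] -/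
private theorem abs_sub_le_core {u s c : ℝ} (hu : 0 < u) (hs : 0 < s) (hc0 : 0 ≤ c) (hc1 : c ≤ 1)
    (hsc : s ^ 2 + c ^ 2 = 1) :
    |u ^ 2 * c * (1 - c) / Real.sqrt (1 + u ^ 2 * s ^ 2) - u * c * s / (1 + c)| ≤
      u * c * s / (1 + u ^ 2 * s ^ 2) := by
  set A := 1 + u ^ 2 * s ^ 2 with hA
  have hApos : 0 < A := by positivity
  set r := Real.sqrt A with hr
  have hrpos : 0 < r := Real.sqrt_pos.2 hApos
  have hr2 : r ^ 2 = A := Real.sq_sqrt hApos.le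
  have hus : u * s ≤ r :=
    calc u * s = Real.sqrt ((u * s) ^ 2) := (Real.sqrt_sq (by positivity)).symm
      _ ≤ r := Real.sqrt_le_sqrt (by rw [hA]; nlinarith)
  -- `s/(1+c) = (1−c)/s`
  have e1 : u * c * s / (1 + c) = u * c * (1 - c) / s := by
    have h1c : (1 + c) ≠ 0 := by positivity
    field_simp
    nlinarith [hsc]
  rw [e1]
  -- the difference, with its sign
  have e2 : u ^ 2 * c * (1 - c) / r - u * c * (1 - c) / s =
      -(u * c * (1 - c) * ((r - u * s) / (r * s))) := by
    field_simp
    ring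
  have hnn : 0 ≤ u * c * (1 - c) * ((r - u * s) / (r * s)) := by
    have : 0 ≤ r - u * s := by linarith
    positivity
  rw [e2, abs_neg, abs_of_nonneg hnn]
  -- `r − us = 1/(r + us) ≤ 1/r`, `1 − c ≤ s²`
  have e3 : r - u * s = 1 / (r + u * s) := by
    have hne : r + u * s ≠ 0 := by positivity
    field_simp
    nlinarith [hr2]
  have h1c : 1 - c ≤ s ^ 2 := by nlinarith
  have hstep1 : u * c * (1 - c) * ((r - u * s) / (r * s)) ≤ u * c * s ^ 2 * ((1 / r) / (r * s)) := by
    have h4 : (r - u * s) / (r * s) ≤ (1 / r) / (r * s) := by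
      apply div_le_div_of_nonneg_right _ (by positivity)
      rw [e3]
      exact one_div_le_one_div_of_le hrpos (by nlinarith [hus, hu.le, hs.le])
    have h5 : 0 ≤ (r - u * s) / (r * s) := by
      have : 0 ≤ r - u * s := by linarith
      positivity
    calc u * c * (1 - c) * ((r - u * s) / (r * s))
        ≤ u * c * (1 - c) * ((1 / r) / (r * s)) :=
          mul_le_mul_of_nonneg_left h4 (by
            have : 0 ≤ 1 - c := by linarith
            positivity)
      _ ≤ u * c * s ^ 2 * ((1 / r) / (r * s)) :=
          mul_le_mul_of_nonneg_right (mul_le_mul_of_nonneg_left h1c (by positivity))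
            (by positivity)
  refine hstep1.trans (le_of_eq ?_)
  rw [← hr2]
  field_simp

/-- The pointwise bound on `(0, π/2]`:
`|u² cos θ(1 − cos θ)/√(1+u² sin²θ) − u cos θ sin θ/(1 + cos θ)| ≤ u cos θ sin θ/(1 + u² sin²θ)`. [folklore] -/
private theorem abs_sub_le_of_mem_Ioc {u : ℝ} (hu : 0 < u) {θ : ℝ} (hθ : θ ∈ Ioc (0 : ℝ) (π / 2)) :
    |u ^ 2 * Real.cos θ * (1 - Real.cos θ) / Real.sqrt (1 + u ^ 2 * Real.sin θ ^ 2) -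
        u * Real.cos θ * Real.sin θ / (1 + Real.cos θ)| ≤
      u * Real.cos θ * Real.sin θ / (1 + u ^ 2 * Real.sin θ ^ 2) := by
  have hs : 0 < Real.sin θ := Real.sin_pos_of_pos_of_lt_pi hθ.1 (by linarith [hθ.2, Real.pi_pos])
  have hc0 : 0 ≤ Real.cos θ := Real.cos_nonneg_of_mem_Icc ⟨by linarith [hθ.1, Real.pi_pos], hθ.2⟩
  have hc1 : Real.cos θ ≤ 1 := Real.cos_le_one θ
  exact abs_sub_le_core hu hs hc0 hc1 (Real.sin_sq_add_cos_sq θ)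

/-- `0 ≤ u·arsinh u − u·log(2u) ≤ 1/(4u)` for `u > 0`
(`arsinh u − log 2u = log((1 + √(1 + u⁻²))/2) ≤ (√(1+u²) − u)/(2u) ≤ 1/(4u²)`). [folklore] -/
private theorem arsinh_sub_log_bounds {u : ℝ} (hu : 0 < u) :
    0 ≤ u * Real.arsinh u - u * Real.log (2 * u) ∧
      u * Real.arsinh u - u * Real.log (2 * u) ≤ 1 / (4 * u) := by
  have hsq : u ≤ Real.sqrt (1 + u ^ 2) :=
    calc u = Real.sqrt (u ^ 2) := (Real.sqrt_sq hu.le).symm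
      _ ≤ Real.sqrt (1 + u ^ 2) := Real.sqrt_le_sqrt (by nlinarith)
  have hq1 : 1 ≤ (u + Real.sqrt (1 + u ^ 2)) / (2 * u) := by
    rw [le_div_iff₀ (by positivity)]
    linarith
  have hq0 : 0 < (u + Real.sqrt (1 + u ^ 2)) / (2 * u) := lt_of_lt_of_le one_pos hq1
  have e : u * Real.arsinh u - u * Real.log (2 * u) =
      u * Real.log ((u + Real.sqrt (1 + u ^ 2)) / (2 * u)) := by
    rw [Real.arsinh, Real.log_div (by positivity) (by positivity)]
    ring
  rw [e]
  refine ⟨mul_nonneg hu.le (Real.log_nonneg hq1), ?_⟩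
  have hlog := Real.log_le_sub_one_of_pos hq0
  -- `q − 1 = (√(1+u²) − u)/(2u) ≤ 1/(4u²)`
  have hroot : Real.sqrt (1 + u ^ 2) - u ≤ 1 / (2 * u) := by
    have h2 : Real.sqrt (1 + u ^ 2) ≤ u + 1 / (2 * u) := by
      rw [Real.sqrt_le_left (by positivity)]
      have : (u + 1 / (2 * u)) ^ 2 = u ^ 2 + 1 + 1 / (4 * u ^ 2) := by
        field_simp
        ring
      rw [this]
      have : 0 ≤ 1 / (4 * u ^ 2) := by positivity
      linarith
    linarith
  have hq : (u + Real.sqrt (1 + u ^ 2)) / (2 * u) - 1 ≤ 1 / (4 * u ^ 2) := by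
    have : (u + Real.sqrt (1 + u ^ 2)) / (2 * u) - 1 = (Real.sqrt (1 + u ^ 2) - u) / (2 * u) := by
      field_simp
      ring
    rw [this]
    calc (Real.sqrt (1 + u ^ 2) - u) / (2 * u) ≤ (1 / (2 * u)) / (2 * u) :=
          div_le_div_of_nonneg_right hroot (by positivity)
      _ = 1 / (4 * u ^ 2) := by field_simp; ring
  calc u * Real.log ((u + Real.sqrt (1 + u ^ 2)) / (2 * u))
      ≤ u * (1 / (4 * u ^ 2)) := mul_le_mul_of_nonneg_left (hlog.trans hq) hu.le
    _ = 1 / (4 * u) := by field_simp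

/-! ### The asymptotic of `T(u) = ∫₀^{π/2} u² cos²θ/√(1+u² sin²θ) dθ` -/

/-- Continuity of `θ ↦ g(θ)/√(1 + u² sin²θ)` for continuous `g` (plumbing). [folklore] -/
private theorem continuous_div_sqrt (u : ℝ) {g : ℝ → ℝ} (hg : Continuous g) :
    Continuous fun θ => g θ / Real.sqrt (1 + u ^ 2 * Real.sin θ ^ 2) :=
  hg.div (Real.continuous_sqrt.comp (continuous_const.add
      (continuous_const.mul (Real.continuous_sin.pow 2))))
    fun θ => (Real.sqrt_pos.2 (one_add_sq_mul_sin_sq_pos u θ)).ne'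

/-- **The key estimate**: for `u > 0`,
`|∫₀^{π/2} u² cos²θ/√(1+u² sin²θ) dθ − (u log(4u) − u)| ≤ 1/(4u) + log(1+u²)/(2u)`. [folklore] -/
private theorem abs_T_sub_main_le {u : ℝ} (hu : 0 < u) :
    |(∫ θ in (0 : ℝ)..(π / 2), u ^ 2 * Real.cos θ ^ 2 / Real.sqrt (1 + u ^ 2 * Real.sin θ ^ 2)) -
        (u * Real.log (4 * u) - u)| ≤
      1 / (4 * u) + Real.log (1 + u ^ 2) / (2 * u) := by
  have hpi : (0 : ℝ) ≤ π / 2 := by positivity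
  -- names for the three integrands
  set f1 : ℝ → ℝ := fun θ => u ^ 2 * Real.cos θ / Real.sqrt (1 + u ^ 2 * Real.sin θ ^ 2) with hf1
  set fR : ℝ → ℝ := fun θ =>
    u ^ 2 * Real.cos θ * (1 - Real.cos θ) / Real.sqrt (1 + u ^ 2 * Real.sin θ ^ 2) with hfR
  set f0 : ℝ → ℝ := fun θ => u * Real.cos θ * Real.sin θ / (1 + Real.cos θ) with hf0
  set fB : ℝ → ℝ := fun θ => u * Real.cos θ * Real.sin θ / (1 + u ^ 2 * Real.sin θ ^ 2) with hfB
  have hc1 : Continuous f1 := continuous_div_sqrt u (continuous_const.mul Real.continuous_cos)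
  have hcR : Continuous fR := continuous_div_sqrt u
    ((continuous_const.mul Real.continuous_cos).mul (continuous_const.sub Real.continuous_cos))
  have hcB : Continuous fB :=
    ((continuous_const.mul Real.continuous_cos).mul Real.continuous_sin).div
      (continuous_const.add (continuous_const.mul (Real.continuous_sin.pow 2)))
      fun θ => (one_add_sq_mul_sin_sq_pos u θ).ne'
  have h0i : IntervalIntegrable f0 volume 0 (π / 2) := by
    refine ContinuousOn.intervalIntegrable fun θ hθ => ?_
    rw [uIcc_of_le hpi] at hθ
    have h0 : 0 < 1 + Real.cos θ := by
      have := Real.cos_nonneg_of_mem_Icc ⟨by linarith [hθ.1, Real.pi_pos], hθ.2⟩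
      linarith
    exact (((continuous_const.mul Real.continuous_cos).mul Real.continuous_sin).continuousAt.div
      (continuous_const.add Real.continuous_cos).continuousAt h0.ne').continuousWithinAt
  -- `T = ∫ f1 − ∫ fR`
  have hT : (∫ θ in (0 : ℝ)..(π / 2), u ^ 2 * Real.cos θ ^ 2 / Real.sqrt (1 + u ^ 2 * Real.sin θ ^ 2))
      = (∫ θ in (0 : ℝ)..(π / 2), f1 θ) - ∫ θ in (0 : ℝ)..(π / 2), fR θ := by
    rw [← integral_sub (hc1.intervalIntegrable _ _) (hcR.intervalIntegrable _ _)]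
    refine integral_congr fun θ _ => ?_
    simp only [hf1, hfR]
    rw [← sub_div]
    ring
  have h1 : ∫ θ in (0 : ℝ)..(π / 2), f1 θ = u * Real.arsinh u := integral_sq_mul_cos_div_sqrt u
  -- `|∫ fR − u c₀| ≤ log(1+u²)/(2u)`
  have h0v : ∫ θ in (0 : ℝ)..(π / 2), f0 θ = u * (1 - Real.log 2) := by
    simp only [hf0]
    rw [← integral_cos_mul_sin_div_one_add_cos, ← intervalIntegral.integral_const_mul]
    refine integral_congr fun θ _ => ?_
    ring
  have hRB : |(∫ θ in (0 : ℝ)..(π / 2), fR θ) - u * (1 - Real.log 2)| ≤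
      Real.log (1 + u ^ 2) / (2 * u) := by
    rw [← h0v, ← integral_sub (hcR.intervalIntegrable _ _) h0i,
      ← integral_mul_cos_mul_sin_div hu.ne']
    have := norm_integral_le_of_norm_le (μ := volume) hpi (f := fun θ => fR θ - f0 θ) (g := fB)
      (ae_of_all _ fun θ hθ => ?_) (hcB.intervalIntegrable _ _)
    · simpa [Real.norm_eq_abs] using this
    · rw [Real.norm_eq_abs]
      exact abs_sub_le_of_mem_Ioc hu hθ
  obtain ⟨hA0, hA1⟩ := arsinh_sub_log_bounds hu
  -- bookkeeping: `u log 2u − u(1 − log 2) = u log 4u − u`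
  have hlog : u * Real.log (2 * u) + u * Real.log 2 = u * Real.log (4 * u) := by
    rw [← mul_add, ← Real.log_mul (by positivity) (by norm_num)]
    congr 1
    ring_nf
  rw [hT, h1]
  have key : u * Real.arsinh u - (∫ θ in (0 : ℝ)..(π / 2), fR θ) - (u * Real.log (4 * u) - u) =
      (u * Real.arsinh u - u * Real.log (2 * u)) -
        ((∫ θ in (0 : ℝ)..(π / 2), fR θ) - u * (1 - Real.log 2)) := by
    linarith [hlog]
  rw [key]
  calc |u * Real.arsinh u - u * Real.log (2 * u) -
          ((∫ θ in (0 : ℝ)..(π / 2), fR θ) - u * (1 - Real.log 2))|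
      ≤ |u * Real.arsinh u - u * Real.log (2 * u)| +
          |(∫ θ in (0 : ℝ)..(π / 2), fR θ) - u * (1 - Real.log 2)| := abs_sub _ _
    _ ≤ 1 / (4 * u) + Real.log (1 + u ^ 2) / (2 * u) := by
        rw [abs_of_nonneg hA0]
        exact add_le_add hA1 hRB

/-! ### `aK(1−a) − E(1−a)` at `a = 1 + u²` -/

/-- For `a = 1 + u²`: `aK(1−a) − E(1−a) = ∫₀^{π/2} u² cos²θ/√(1 + u² sin²θ) dθ`. [folklore] -/
private theorem ellipticK_sub_ellipticE_eq (u : ℝ) :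
    (1 + u ^ 2) * ellipticK (1 - (1 + u ^ 2)) - ellipticE (1 - (1 + u ^ 2)) =
      ∫ θ in (0 : ℝ)..(π / 2), u ^ 2 * Real.cos θ ^ 2 / Real.sqrt (1 + u ^ 2 * Real.sin θ ^ 2) := by
  unfold ellipticK ellipticE
  have e : ∀ θ : ℝ, 1 - (1 - (1 + u ^ 2)) * Real.sin θ ^ 2 = 1 + u ^ 2 * Real.sin θ ^ 2 := by
    intro θ; ring
  simp_rw [e]
  have hcK : Continuous fun θ => 1 / Real.sqrt (1 + u ^ 2 * Real.sin θ ^ 2) :=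
    continuous_div_sqrt u continuous_const
  have hcE : Continuous fun θ => Real.sqrt (1 + u ^ 2 * Real.sin θ ^ 2) :=
    Real.continuous_sqrt.comp (continuous_const.add
      (continuous_const.mul (Real.continuous_sin.pow 2)))
  rw [← intervalIntegral.integral_const_mul,
    ← integral_sub ((hcK.intervalIntegrable _ _).const_mul _) (hcE.intervalIntegrable _ _)]
  refine integral_congr fun θ _ => ?_
  have hA := one_add_sq_mul_sin_sq_pos u θ
  have hr : 0 < Real.sqrt (1 + u ^ 2 * Real.sin θ ^ 2) := Real.sqrt_pos.2 hA
  have hr2 : Real.sqrt (1 + u ^ 2 * Real.sin θ ^ 2) ^ 2 = 1 + u ^ 2 * Real.sin θ ^ 2 :=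
    Real.sq_sqrt hA.le
  have hsc : Real.sin θ ^ 2 + Real.cos θ ^ 2 = 1 := Real.sin_sq_add_cos_sq θ
  field_simp
  nlinarith [hr2, hsc]

/-! ### The discharge -/

/-- `1/(4u) + log(1+u²)/(2u) → 0` as `u → ∞`. [folklore] -/
private theorem tendsto_errorBound :
    Tendsto (fun u : ℝ => 1 / (4 * u) + Real.log (1 + u ^ 2) / (2 * u)) atTop (𝓝 0) := by
  rw [show (0 : ℝ) = 0 + 0 by simp]
  refine Tendsto.add ?_ ?_
  · have : Tendsto (fun u : ℝ => 4 * u) atTop atTop :=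
      Tendsto.const_mul_atTop (by norm_num) tendsto_id
    exact tendsto_const_nhds.div_atTop this
  · -- squeeze between `0` and `log(1+u)/u = log x/(1·x − 1)` at `x = 1 + u`
    have hmain : Tendsto (fun u : ℝ => Real.log (1 + u) / u) atTop (𝓝 0) := by
      have h := (Real.tendsto_pow_log_div_mul_add_atTop 1 (-1) 1 one_ne_zero).comp
        (tendsto_atTop_add_const_left atTop 1 tendsto_id)
      refine h.congr' (Eventually.of_forall fun u => ?_)
      simp
    refine squeeze_zero' ?_ ?_ hmain
    · filter_upwards [eventually_gt_atTop (0 : ℝ)] with u hu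
      exact div_nonneg (Real.log_nonneg (by nlinarith)) (by positivity)
    · filter_upwards [eventually_gt_atTop (0 : ℝ)] with u hu
      have hlog : Real.log (1 + u ^ 2) ≤ 2 * Real.log (1 + u) := by
        rw [← Real.log_rpow (by positivity), Real.rpow_two]
        exact Real.log_le_log (by positivity) (by nlinarith)
      calc Real.log (1 + u ^ 2) / (2 * u) ≤ 2 * Real.log (1 + u) / (2 * u) :=
            div_le_div_of_nonneg_right hlog (by positivity)
        _ = Real.log (1 + u) / u := by field_simp

/-- RH-FREE, PROVED: discharge of the named fact `CM22_prop_3_2` (**Proposition 3.2** = arXiv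
Prop. 4.2, eq. (3.5)/(4.5): the semiclassical area `σ(E,λ)` of `Ω_λ(E)` satisfies
`σ(E,λ) − [(E/2π)(log(E/2π) − 1 + log 4 − 2 log λ) + λ²] → 0` as `E → ∞`).  Printed proof
(p0009:L82–L100): (3.3) `σ = λ²I(a/λ⁴)`, Lemma 3.1 `I(a) = aK(1−a) − E(1−a) + 1` (both landed,
seat t8: `CM22_eq_3_3_holds`, `CM22_lemma_3_1_holds`) and the expansion (3.6) of `I(a)` as `a → ∞`.
Here (3.6) is replaced by the elementary estimate it amounts to (route: seat t15): with
`u := E/(2πλ²)` one has exactly `a/λ⁴ = 1 + u²`, `aK − E = ∫₀^{π/2} u²cos²θ/√(1+u²sin²θ) dθ`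
`= u·arsinh u − ∫₀^{π/2} u²cos θ(1 − cos θ)/√(1+u²sin²θ) dθ`, the main term equals
`λ²(u log 4u − u + 1)`, and `|σ(E,λ) − main| ≤ λ²(1/(4u) + log(1+u²)/(2u))`
(`0 ≤ u·arsinh u − u log 2u ≤ 1/(4u)`; `c₀ = ∫₀^{π/2} cos θ sin θ/(1+cos θ) dθ = 1 − log 2`;
`|∫ u²cos θ(1−cos θ)/√(1+u²sin²θ) − u c₀| ≤ ∫ u cos θ sin θ/(1+u²sin²θ) = log(1+u²)/(2u)`).
A SEMICLASSICAL statement about the phase-space area, not about the true eigenvalue count.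
[cite: ConnesMoscovici2022, Prop 3.2 eq. (3.5) (= arXiv Prop 4.2 (4.5), chunk p0009:L74–L80; proof L82–L100)] -/
theorem CM22_prop_3_2_holds : CM22_prop_3_2 := by
  intro lam hlam
  have h33 := CM22_eq_3_3_holds
  have h31 := CM22_lemma_3_1_holds
  -- the error bound along `u(E) = E/(2πλ²) → ∞`
  have hu : Tendsto (fun E : ℝ => E / (2 * π * lam ^ 2)) atTop atTop :=
    tendsto_id.atTop_div_const (by positivity)
  have hbound : Tendsto (fun E : ℝ => lam ^ 2 * (1 / (4 * (E / (2 * π * lam ^ 2))) +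
      Real.log (1 + (E / (2 * π * lam ^ 2)) ^ 2) / (2 * (E / (2 * π * lam ^ 2))))) atTop (𝓝 0) := by
    simpa using (tendsto_errorBound.comp hu).const_mul (lam ^ 2)
  refine squeeze_zero_norm' ?_ hbound
  filter_upwards [eventually_gt_atTop (0 : ℝ)] with E hE
  set u : ℝ := E / (2 * π * lam ^ 2) with hu_def
  have hupos : 0 < u := by positivity
  have hEu : E / (2 * π) = lam ^ 2 * u := by
    rw [hu_def]; field_simp
  -- `σ = λ²(T(u) + 1)`
  have ha4 : lam ^ 4 ≤ (E / (2 * π)) ^ 2 + lam ^ 4 := by nlinarith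
  have hb : ((E / (2 * π)) ^ 2 + lam ^ 4) * (lam ^ 4)⁻¹ = 1 + u ^ 2 := by
    rw [hEu]; field_simp; ring
  have hσ : cmSigma E lam =
      lam ^ 2 * ((∫ θ in (0 : ℝ)..(π / 2),
        u ^ 2 * Real.cos θ ^ 2 / Real.sqrt (1 + u ^ 2 * Real.sin θ ^ 2)) + 1) := by
    obtain ⟨h1, h2⟩ := h33 lam E hlam hE.le
    rw [h1, h2 _ ha4, hb, h31 _ (by nlinarith), ← ellipticK_sub_ellipticE_eq u]
  -- `main = λ²(u log 4u − u + 1)`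
  have hmain : cmSigmaMain E lam = lam ^ 2 * (u * Real.log (4 * u) - u + 1) := by
    unfold cmSigmaMain
    rw [hEu, Real.log_mul (by positivity) hupos.ne', Real.log_mul (by norm_num) hupos.ne',
      Real.log_pow]
    push_cast
    ring
  rw [hσ, hmain, Real.norm_eq_abs]
  have e : lam ^ 2 * ((∫ θ in (0 : ℝ)..(π / 2),
        u ^ 2 * Real.cos θ ^ 2 / Real.sqrt (1 + u ^ 2 * Real.sin θ ^ 2)) + 1) -
      lam ^ 2 * (u * Real.log (4 * u) - u + 1) =
      lam ^ 2 * ((∫ θ in (0 : ℝ)..(π / 2),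
        u ^ 2 * Real.cos θ ^ 2 / Real.sqrt (1 + u ^ 2 * Real.sin θ ^ 2)) -
        (u * Real.log (4 * u) - u)) := by ring
  rw [e, abs_mul, abs_of_nonneg (by positivity : (0 : ℝ) ≤ lam ^ 2)]
  exact mul_le_mul_of_nonneg_left (abs_T_sub_main_le hupos) (by positivity)

end Semiclassical

end Literature.NumberTheory.ConnesMoscovici2022
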